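import Summits.AnomalousDissipation.AnomalousDissipation.Theorems.MomentParityQuarticGateOrder3SymKernel
import Summits.AnomalousDissipation.AnomalousDissipation.Theorems.MomentParityQuarticGateAssembly

/-!
# Order-3 surgery for `MomentParity.QuarticGate` (stmt-AnomalousDissipation-11464), line
# `axis-sectors`, stub `stub_order3SurgerySym` (S5b), helper I′: the Casimir-free assembly

`order3Surgery_of_casimirRows` is the conditional assembly `order3Surgery_of` of the line
`recession-cone` (`…MomentParityQuarticGateAssembly`) — a level-`N` probability law `μ₁` with finite
fourth moments, SLATER in degree `4` (band form), 3-STATIONARY, with the energy and dissipation of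
`μ₀` — with its three Casimir hypotheses (vanishing ENERGY row, vanishing HELICITY row, QuadRigidity
at level `N`) replaced by the single hypothesis its kernel step consumes: the `μ₀`-row of EVERY
homogeneous quadratic Casimir vanishes (`hCas`). Proof verbatim, through the Casimir-free kernel
`exists_shifted_sequence_of_casimirRows` (`…Order3SymKernel`). No symmetry is involved here; the
symmetric version is `Order3Sym.order3SurgerySym_of` (`…StubOrder3SurgerySym`).
-/

-- `Summit.<Summit>.<Problem>` is the tree's mandated summit-side namespace (CONVENTIONS §2); for this
-- single-conjunct summit the two coincide, so the duplicate is deliberate.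
set_option linter.dupNamespace false

namespace Summit.AnomalousDissipation.AnomalousDissipation.Theorems.MomentParityQuarticGate

open scoped BigOperators InnerProductSpace RealInnerProductSpace ENNReal
open MeasureTheory MvPolynomial Literature.MeasureTheory.Moments
open Literature.Analysis.FunctionSpaces Literature.Analysis.FluidPDE
open Summit.AnomalousDissipation.AnomalousDissipation.Theorems.QuarticGate.Negative

/-- **Order-3 surgery + Slater upgrade, conditional form, CASIMIR-FREE interface.** See the module
docstring. All infrastructure enters as hypotheses (`hsumband`, `horth`, `hpb`, `hgb`, `hlev`, `hnorm`
= I2; `hReal` = I3; `hRow` = I4; `hDiss` = I5); the hypotheses on `μ₀` are those of the stub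
`stub_order3Surgery` with (energy row, helicity row, QuadRigidity) replaced by `hCas`: the row of
every homogeneous quadratic Casimir vanishes. [folklore] -/
-- adapted from …Theorems/MomentParityQuarticGateAssembly.lean (`order3Surgery_of`): only the kernel
-- step call differs.
theorem order3Surgery_of_casimirRows :
    ∀ {N n : ℕ} {b : Fin n → UnitAddTorus (Fin 3) → EuclideanSpace ℝ (Fin 3)}, (∀ i, IsBandTest N (b
      i)) → (∀ ξ : Fin n → ℝ, IsBandTest N (fun x => ∑ i, ξ i • b i x)) → (∀ (ξ : Fin n → ℝ) (i :
      Fin n), ∫ y, ⟪∑ j, ξ j • b j y, b i y⟫_ℝ = ξ i) → (∀ g : UnitAddTorus (Fin 3) → EuclideanSpace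
      ℝ (Fin 3), IsBandTest N g → ∀ u : Torus.energySpace (Fin 3), Torus.pairing u.1 g = ∑ i, (∫ y,
      ⟪g y, b i y⟫_ℝ) * Torus.pairing u.1 (b i)) → (∀ g : UnitAddTorus (Fin 3) → EuclideanSpace ℝ
      (Fin 3), IsBandTest N g → ∀ x, g x = ∑ i, (∫ y, ⟪g y, b i y⟫_ℝ) • b i x) → (∀ x : Fin n → ℝ, ∃
      u : Torus.energySpace (Fin 3), IsLevel N u ∧ (fun i => Torus.pairing u.1 (b i)) = x) → (∀ u :
      Torus.energySpace (Fin 3), IsLevel N u → ‖u‖ ^ 2 = ∑ i, (Torus.pairing u.1 (b i)) ^ 2) → ∀ (ν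
      : ℝ) {f : UnitAddTorus (Fin 3) → EuclideanSpace ℝ (Fin 3)}, Torus.IsSmooth f → (∀ y : (Fin n
      →₀ ℕ) → ℝ, y 0 = 1 → Literature.MeasureTheory.Moments.IsStrictlyKPositive (Set.univ : Set (Fin
      n → ℝ)) 4 y → ∃ μ : Measure (Torus.energySpace (Fin 3)), IsProbabilityMeasure μ ∧ (∀ᵐ u ∂μ,
      IsLevel N u) ∧ Integrable (fun u : Torus.energySpace (Fin 3) => ‖u‖ ^ 4) μ ∧ ∀ Q :
      MvPolynomial (Fin n) ℝ, Q.totalDegree ≤ 4 → Integrable (fun u : Torus.energySpace (Fin 3) =>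
      MvPolynomial.eval (fun i => Torus.pairing u.1 (b i)) Q) μ ∧ ∫ u, MvPolynomial.eval (fun i =>
      Torus.pairing u.1 (b i)) Q ∂μ = Literature.MeasureTheory.Moments.rieszFunctional y Q) → (∀ (m
      : ℕ) (g : Fin m → UnitAddTorus (Fin 3) → EuclideanSpace ℝ (Fin 3)), (∀ i, IsBandTest N (g i))
      → ∀ (P : MvPolynomial (Fin m) ℝ) (d : ℕ), P.totalDegree ≤ d → ∃ Q : MvPolynomial (Fin n) ℝ,
      Q.totalDegree ≤ d + 1 ∧ (∀ u : Torus.energySpace (Fin 3), IsLevel N u →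
      Torus.nsGeneratorPairing ν f u (polyGrad g P u) = MvPolynomial.eval (fun i => Torus.pairing
      u.1 (b i)) Q) ∧ (∀ u : Torus.energySpace (Fin 3), IsLevel N u → MvPolynomial.eval (fun i =>
      Torus.pairing u.1 (b i)) (MvPolynomial.homogeneousComponent (d + 1) Q) =
      Torus.nsGeneratorPairing (d := Fin 3) 0 0 u (polyGrad g (MvPolynomial.homogeneousComponent d
      P) u))) → (∃ D : MvPolynomial (Fin n) ℝ, D.totalDegree ≤ 2 ∧ ∀ u : Torus.energySpace (Fin 3),
      IsLevel N u → (Torus.eGradNormSq (u.1 : UnitAddTorus (Fin 3) → EuclideanSpace ℝ (Fin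
      3))).toReal = MvPolynomial.eval (fun i => Torus.pairing u.1 (b i)) D) → ∀ (μ₀ : Measure
      (Torus.energySpace (Fin 3))) [IsProbabilityMeasure μ₀], (∀ᵐ u ∂μ₀, IsLevel N u) → (∃ R : ℝ, ∀ᵐ
      u ∂μ₀, ‖u‖ ≤ R) → (∀ g : UnitAddTorus (Fin 3) → EuclideanSpace ℝ (Fin 3), IsBandTest N g → (∃
      u : Torus.energySpace (Fin 3), IsLevel N u ∧ Torus.pairing u.1 g ≠ 0) → (∫ u, Torus.pairing
      u.1 g ∂μ₀) ^ 2 < ∫ u, (Torus.pairing u.1 g) ^ 2 ∂μ₀) → (∀ g : UnitAddTorus (Fin 3) →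
      EuclideanSpace ℝ (Fin 3), IsBandTest N g → Integrable (fun u : Torus.energySpace (Fin 3) =>
      Torus.nsGeneratorPairing ν f u g) μ₀ ∧ ∫ u, Torus.nsGeneratorPairing ν f u g ∂μ₀ = 0) →
      (∀ (m : ℕ) (g : Fin m → UnitAddTorus (Fin 3) → EuclideanSpace ℝ (Fin 3)) (P : MvPolynomial
      (Fin m) ℝ), (∀ i, IsBandTest N (g i)) → P.IsHomogeneous 2 → (∀ u : Torus.energySpace (Fin 3),
      IsLevel N u → Torus.nsGeneratorPairing (d := Fin 3) 0 0 u (polyGrad g P u) = 0) →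
      ∫ u, Torus.nsGeneratorPairing ν f u (polyGrad g P u) ∂μ₀ = 0)
      → ∃ μ₁ : Measure (Torus.energySpace (Fin 3)), IsProbabilityMeasure μ₁ ∧ (∀ᵐ u ∂μ₁, IsLevel N
      u) ∧ Integrable (fun u : Torus.energySpace (Fin 3) => ‖u‖ ^ 4) μ₁ ∧ (∀ (m : ℕ) (g : Fin m →
      UnitAddTorus (Fin 3) → EuclideanSpace ℝ (Fin 3)) (P : MvPolynomial (Fin m) ℝ), (∀ i,
      IsBandTest N (g i)) → P.totalDegree ≤ 4 → (∀ u : Torus.energySpace (Fin 3), IsLevel N u → 0 ≤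
      MvPolynomial.eval (fun j => Torus.pairing u.1 (g j)) P) → (∃ u : Torus.energySpace (Fin 3),
      IsLevel N u ∧ MvPolynomial.eval (fun j => Torus.pairing u.1 (g j)) P ≠ 0) → 0 < ∫ u,
      MvPolynomial.eval (fun j => Torus.pairing u.1 (g j)) P ∂μ₁) ∧ IsPolyStationary ν f N 3 μ₁ ∧
      Torus.ensembleEnergy μ₁ = Torus.ensembleEnergy μ₀ ∧ Torus.ensembleDissipation ν μ₁ =
      Torus.ensembleDissipation ν μ₀ := by
  intro N n b hb hsumband horth hpb hgb hlev hnorm ν f hf hReal hRow hDiss μ₀ _ hl₀ hbdd hnd hlinrow hCas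
  classical
  have hbs : ∀ i, Torus.IsSmooth (b i) := fun i => (hb i).1
  have hlin : ∀ (u : Torus.energySpace (Fin 3)) (ξ : Fin n → ℝ),
      Torus.pairing u.1 (fun x => ∑ i, ξ i • b i x) = ∑ i, ξ i * Torus.pairing u.1 (b i) := by
    intro u ξ
    rw [hpb _ (hsumband ξ) u]
    simp_rw [horth ξ]
  -- the target sequence and the new law
  obtain ⟨y₀, y, hmom, hy0, hypos, hyeq, hrows⟩ := exists_shifted_sequence_of_casimirRows hb hsumband
    hlin hlev ν hf μ₀ hl₀ hbdd hnd (fun P hP h0 => hCas n b P hb hP h0) (fun P d hP => hRow n b hb P d hP)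
  obtain ⟨μ₁, hp₁, hl₁, hi₁, hint⟩ := hReal y hy0 hypos
  have hyeq' : ∀ α : Fin n →₀ ℕ, α.degree ≤ 2 → y α = y₀ α := hyeq
  -- transport data of a band test family
  have htrans : ∀ (m : ℕ) (g : Fin m → UnitAddTorus (Fin 3) → EuclideanSpace ℝ (Fin 3)),
      (∀ i, IsBandTest N (g i)) → ∀ P : MvPolynomial (Fin m) ℝ,
      (∀ u : Torus.energySpace (Fin 3), eval (fun j => Torus.pairing u.1 (g j)) P =
        eval (fun i => Torus.pairing u.1 (b i))
          (bind₁ (fun j => ∑ i, C (∫ y, ⟪g j y, b i y⟫_ℝ) * (X i : MvPolynomial (Fin n) ℝ)) P)) ∧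
      (∀ u : Torus.energySpace (Fin 3), polyGrad g P u =
        polyGrad b (bind₁ (fun j => ∑ i, C (∫ y, ⟪g j y, b i y⟫_ℝ) * (X i : MvPolynomial (Fin n) ℝ)) P) u) :=
    fun m g hg P =>
      ⟨fun u => eval_pairing_transport (fun j i => ∫ y, ⟪g j y, b i y⟫_ℝ) (fun u j => hpb _ (hg j) u) P u,
        fun u => funext fun x => polyGrad_transport (fun j i => ∫ y, ⟪g j y, b i y⟫_ℝ)
          (fun j x => hgb _ (hg j) x) (fun u j => hpb _ (hg j) u) P u x⟩
  refine ⟨μ₁, hp₁, hl₁, hi₁, ?_, ?_, ?_, ?_⟩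
  · -- SLATER in degree 4, band form
    intro m g P hg hP4 hnn hex
    obtain ⟨hev, -⟩ := htrans m g hg P
    set P' := bind₁ (fun j => ∑ i, C (∫ y, ⟪g j y, b i y⟫_ℝ) * (X i : MvPolynomial (Fin n) ℝ)) P with hP'
    have hdeg : P'.totalDegree ≤ 4 := (totalDegree_bind₁_linear_le _ P).trans hP4
    have hpos : 0 < rieszFunctional y P' := by
      refine hypos.2 P' hdeg (fun x _ => ?_) ?_
      · obtain ⟨u, hu, hux⟩ := hlev x
        rw [← hux, ← hev u]
        exact hnn u hu
      · obtain ⟨u, hu, hne⟩ := hex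
        exact ⟨_, Set.mem_univ _, by rw [← hev u]; exact hne⟩
    simp_rw [hev]
    rw [(hint P' hdeg).2]
    exact hpos
  · -- 3-STATIONARITY
    intro m g P hg hP
    obtain ⟨-, hgrad⟩ := htrans m g hg P
    set P' := bind₁ (fun j => ∑ i, C (∫ y, ⟪g j y, b i y⟫_ℝ) * (X i : MvPolynomial (Fin n) ℝ)) P with hP'
    have hdeg : P'.totalDegree ≤ 2 := (totalDegree_bind₁_linear_le _ P).trans (by omega)
    set P₂ := homogeneousComponent 2 P' with hP₂
    set P₁ := P' - homogeneousComponent 2 P' with hP₁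
    have hP₂h : P₂.IsHomogeneous 2 := homogeneousComponent_isHomogeneous 2 P'
    have hP₁d : P₁.totalDegree ≤ 1 := totalDegree_sub_homogeneousComponent_two_le P' hdeg
    obtain ⟨Q₂, hQ₂deg, hQ₂row, -⟩ := hRow n b hb P₂ 2 hP₂h.totalDegree_le
    obtain ⟨Q₁, hQ₁deg, hQ₁row, -⟩ := hRow n b hb P₁ 1 hP₁d
    -- the row integrand on level-`N` fields
    have hPsplit : P' = ∑ k : Fin 2, (1 : ℝ) • (![P₂, P₁] : Fin 2 → MvPolynomial (Fin n) ℝ) k := by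
      rw [Fin.sum_univ_two]
      simp [hP₂, hP₁]
    have hsplit : ∀ u : Torus.energySpace (Fin 3), IsLevel N u →
        Torus.nsGeneratorPairing ν f u (polyGrad g P u) =
          eval (fun i => Torus.pairing u.1 (b i)) (Q₂ + Q₁) := fun u hu => by
      rw [hgrad u, hPsplit, nsGeneratorPairing_polyGrad_sum_smul ν hf hbs, Fin.sum_univ_two, map_add]
      simp [hQ₂row u hu, hQ₁row u hu]
    have hQdeg : (Q₂ + Q₁).totalDegree ≤ 4 :=
      (totalDegree_add _ _).trans (max_le (hQ₂deg.trans (by norm_num)) (hQ₁deg.trans (by norm_num)))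
    refine ⟨(hint _ hQdeg).1.congr (hl₁.mono fun u hu => (hsplit u hu).symm), ?_⟩
    rw [integral_congr_ae (hl₁.mono fun u hu => hsplit u hu), (hint _ hQdeg).2, rieszFunctional_add,
      hrows P₂ hP₂h Q₂ hQ₂deg hQ₂row, zero_add,
      rieszFunctional_congr_of_totalDegree_le (k := 2) hyeq' hQ₁deg, ← (hmom Q₁).2,
      ← integral_congr_ae (hl₀.mono fun u hu => hQ₁row u hu)]
    -- the test of degree `≤ 1` has a constant differential: a fixed band field
    have hw : ∀ u : Torus.energySpace (Fin 3), polyGrad b P₁ u =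
        fun x => ∑ i, P₁.coeff (Finsupp.single i 1) • b i x := fun u => by
      funext x
      unfold polyGrad
      simp_rw [pderiv_eq_C_of_totalDegree_le_one P₁ hP₁d, eval_C]
    simp_rw [hw]
    exact (hlinrow _ (hsumband _)).2
  · -- ENERGY
    have hev : ∀ u : Torus.energySpace (Fin 3), IsLevel N u →
        ‖u‖ ^ 2 = eval (fun i => Torus.pairing u.1 (b i)) (∑ i, (X i : MvPolynomial (Fin n) ℝ) ^ 2) :=
      fun u hu => by rw [hnorm u hu]; simp [map_sum]
    unfold Torus.ensembleEnergy
    rw [integral_congr_ae (hl₁.mono fun u hu => hev u hu), integral_congr_ae (hl₀.mono fun u hu => hev u hu),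
      (hint _ ((totalDegree_sum_X_sq_le n).trans (by norm_num))).2, (hmom _).2]
    exact rieszFunctional_congr_of_totalDegree_le (k := 2) hyeq' (totalDegree_sum_X_sq_le n)
  · -- DISSIPATION
    obtain ⟨D, hDdeg, hD⟩ := hDiss
    unfold Torus.ensembleDissipation Torus.ensembleEnstrophy
    rw [toReal_lintegral_eGradNormSq_eq D hD μ₁ hl₁ (hint D (hDdeg.trans (by norm_num))).1,
      toReal_lintegral_eGradNormSq_eq D hD μ₀ hl₀ (hmom D).1, (hint D (hDdeg.trans (by norm_num))).2,
      (hmom D).2, rieszFunctional_congr_of_totalDegree_le (k := 2) hyeq' hDdeg]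

end Summit.AnomalousDissipation.AnomalousDissipation.Theorems.MomentParityQuarticGate
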